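import Literature.Computability.AlgebraicComplexity.GroupTheoreticMatMul
import Literature.Combinatorics.Additive.SliceRankMethod
import Mathlib.Logic.Equiv.Fin.Basic
import Mathlib.Data.Finset.Prod

/-!
# Products of STPP families, and singleton STPP families as tricolored sum-free sets

Cell `pub-omega`, STPP track (family b′), seat pub-omega-stpp-2 (gen 6). HONEST FRAMING: lottery ticket; floor =
certified bounds/negative ranges. Two TOOL facts of the finite STPP census in kernel form; nothing here is progress on `ω`.

* `IsSTPP.prod` — **the product of two STPP families is an STPP family** (Cohn–Kleinberg–Szegedy–Umans 2005, the remark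
  after Def. 5.1 / proof of Thm. 7.1 that simultaneous TPP families multiply in direct products): from `(Aᵢ, Bᵢ, Cᵢ)_{i<N}`
  in `H₁` and `(A'ⱼ, B'ⱼ, C'ⱼ)_{j<N'}` in `H₂` one gets the `N·N'` triples `(Aᵢ × A'ⱼ, Bᵢ × B'ⱼ, Cᵢ × C'ⱼ)` in `H₁ × H₂`
  (indexed by `Fin (N·N')` through `finProdFinEquiv`), with `|Aᵢ × A'ⱼ| = |Aᵢ| |A'ⱼ|` etc. (`exists_isSTPP_prod`).
* `isSTPP_singleton_iff_isTricoloredSumFree` — a family of SINGLETONS `({pᵢ}, {qᵢ}, {rᵢ})` (size pattern `(1,1,1)^k`) is an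
  STPP family iff `(pᵢ − qᵢ, qᵢ − rᵢ, rᵢ − pᵢ)ᵢ` is a tricolored sum-free set (tree `IsTricoloredSumFree`, BCCGNSU 2017
  Def. 3.1): the Def-5.1 word of the singleton family IS `σᵢ + τⱼ + υₖ`.  Hence "(1,1,1)^k ⊆ H" and "H has a k-element
  tricolored sum-free set" are the same census cell, and `STPPTricoloredProduct.isSTPP_prodTSF` is the special case
  `IsSTPP.prod` with a singleton second factor.

References: H. Cohn, R. Kleinberg, B. Szegedy, C. Umans, *Group-theoretic algorithms for matrix multiplication*, FOCS 2005
(arXiv:math/0511460), Def. 5.1, §7; J. Blasiak, T. Church, H. Cohn, J. A. Grochow, E. Naslund, W. F. Sawin, C. Umans,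
*On cap sets and the group-theoretic approach to matrix multiplication*, Discrete Analysis 2017:3, Def. 3.1.
-/

open Literature.Computability.AlgebraicComplexity Literature.Combinatorics.Additive Finset

namespace Summit.MatrixMultiplication.OmegaCensus

section Prod

variable {H₁ H₂ : Type*} {N N' : ℕ}

variable [AddCommGroup H₁] [AddCommGroup H₂]

/-- **Products of STPP families are STPP families** (CKSU 2005: simultaneous TPP families in `H₁` and `H₂` give one in
`H₁ × H₂` by taking all products of triples).  Proof: the two components of the defining word are the defining words of the
two factors. [cite: CohnKleinbergSzegedyUmans2005, Def. 5.1] -/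
theorem _root_.Literature.Computability.AlgebraicComplexity.IsSTPP.prod {A B C : Fin N → Finset H₁}
    {A' B' C' : Fin N' → Finset H₂} (h : IsSTPP A B C) (h' : IsSTPP A' B' C') :
    IsSTPP (fun m : Fin (N * N') => A (finProdFinEquiv.symm m).1 ×ˢ A' (finProdFinEquiv.symm m).2)
      (fun m => B (finProdFinEquiv.symm m).1 ×ˢ B' (finProdFinEquiv.symm m).2)
      (fun m => C (finProdFinEquiv.symm m).1 ×ˢ C' (finProdFinEquiv.symm m).2) := by
  intro i j k s hs s' hs' t ht t' ht' u hu u' hu' h0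
  simp only [mem_product] at hs hs' ht ht' hu hu'
  have h1 : (s'.1 - s.1) + (t'.1 - t.1) + (u'.1 - u.1) = 0 := by
    have := congrArg Prod.fst h0; simpa using this
  have h2 : (s'.2 - s.2) + (t'.2 - t.2) + (u'.2 - u.2) = 0 := by
    have := congrArg Prod.snd h0; simpa using this
  obtain ⟨hij₁, hjk₁, hs₁, ht₁, hu₁⟩ := h _ _ _ s.1 hs.1 s'.1 hs'.1 t.1 ht.1 t'.1 ht'.1 u.1 hu.1 u'.1 hu'.1 h1
  obtain ⟨hij₂, hjk₂, hs₂, ht₂, hu₂⟩ := h' _ _ _ s.2 hs.2 s'.2 hs'.2 t.2 ht.2 t'.2 ht'.2 u.2 hu.2 u'.2 hu'.2 h2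
  refine ⟨finProdFinEquiv.symm.injective (Prod.ext hij₁ hij₂), finProdFinEquiv.symm.injective (Prod.ext hjk₁ hjk₂),
    Prod.ext hs₁ hs₂, Prod.ext ht₁ ht₂, Prod.ext hu₁ hu₂⟩

/-- **Existential packaging**: size patterns multiply — if `H₁` realises `(aᵢ, bᵢ, cᵢ)_{i<N}` and `H₂` realises
`(a'ⱼ, b'ⱼ, c'ⱼ)_{j<N'}` then `H₁ × H₂` realises `(aᵢa'ⱼ, bᵢb'ⱼ, cᵢc'ⱼ)_{(i,j)}`. [cite: CohnKleinbergSzegedyUmans2005, Def. 5.1] -/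
theorem exists_isSTPP_prod {a b c : Fin N → ℕ} {a' b' c' : Fin N' → ℕ}
    (h : ∃ A B C : Fin N → Finset H₁, IsSTPP A B C ∧ ∀ i, (A i).card = a i ∧ (B i).card = b i ∧ (C i).card = c i)
    (h' : ∃ A B C : Fin N' → Finset H₂, IsSTPP A B C ∧ ∀ j, (A j).card = a' j ∧ (B j).card = b' j ∧ (C j).card = c' j) :
    ∃ A B C : Fin (N * N') → Finset (H₁ × H₂), IsSTPP A B C ∧ ∀ m,
      (A m).card = a (finProdFinEquiv.symm m).1 * a' (finProdFinEquiv.symm m).2 ∧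
      (B m).card = b (finProdFinEquiv.symm m).1 * b' (finProdFinEquiv.symm m).2 ∧
      (C m).card = c (finProdFinEquiv.symm m).1 * c' (finProdFinEquiv.symm m).2 := by
  obtain ⟨A, B, C, hS, hc⟩ := h
  obtain ⟨A', B', C', hS', hc'⟩ := h'
  refine ⟨_, _, _, hS.prod hS', fun m => ?_⟩
  obtain ⟨e1, e2, e3⟩ := hc (finProdFinEquiv.symm m).1
  obtain ⟨f1, f2, f3⟩ := hc' (finProdFinEquiv.symm m).2
  simp only [card_product, e1, e2, e3, f1, f2, f3, and_self]

end Prod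

section Singletons

variable {H : Type*} [AddCommGroup H] {k : ℕ}

/-- **Singleton STPP families are tricolored sum-free sets.** For points `p q r : Fin k → H`, the family of singletons
`({pᵢ}, {qᵢ}, {rᵢ})` (size pattern `(1,1,1)^k`) satisfies CKSU Def. 5.1 iff `(pᵢ − qᵢ)`, `(qᵢ − rᵢ)`, `(rᵢ − pᵢ)` form a
tricolored sum-free set: with `s = p_k, s' = p_i, t = q_i, t' = q_j, u = r_j, u' = r_k` the defining word
`(s' − s) + (t' − t) + (u' − u)` equals `(pᵢ − qᵢ) + (qⱼ − rⱼ) + (r_k − p_k)`. [cite: CohnKleinbergSzegedyUmans2005, Def. 5.1]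
[cite: BlasiakChurchCohnGrochowNaslundSawinUmans2017, Def. 3.1] -/
theorem isSTPP_singleton_iff_isTricoloredSumFree (p q r : Fin k → H) :
    IsSTPP (fun i => ({p i} : Finset H)) (fun i => {q i}) (fun i => {r i}) ↔
      IsTricoloredSumFree (fun i => p i - q i) (fun i => q i - r i) (fun i => r i - p i) := by
  constructor
  · intro hS i j l
    constructor
    · intro h0
      have e : (p i - p l) + (q j - q i) + (r l - r j) = 0 := by
        have : (p i - p l) + (q j - q i) + (r l - r j) = (p i - q i) + (q j - r j) + (r l - p l) := by abel
        rw [this, h0]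
      obtain ⟨hij, hjl, -⟩ := hS i j l (p l) (mem_singleton_self _) (p i) (mem_singleton_self _) (q i)
        (mem_singleton_self _) (q j) (mem_singleton_self _) (r j) (mem_singleton_self _) (r l) (mem_singleton_self _) e
      exact ⟨hij, hjl⟩
    · rintro ⟨rfl, rfl⟩; dsimp only; abel
  · intro hT i j l s hs s' hs' t ht t' ht' u hu u' hu' h0
    rw [mem_singleton] at hs hs' ht ht' hu hu'
    subst hs hs' ht ht' hu hu'
    have e : (p i - q i) + (q j - r j) + (r l - p l) = 0 := by
      have : (p i - q i) + (q j - r j) + (r l - p l) = (p i - p l) + (q j - q i) + (r l - r j) := by abel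
      rw [this, h0]
    obtain ⟨rfl, rfl⟩ := (hT i j l).1 e
    exact ⟨rfl, rfl, rfl, rfl, rfl⟩

/-- Consequently a `k`-element tricolored sum-free set `(σ, τ, υ)` in `H` yields the size pattern `(1,1,1)^k` in `H`:
take `pᵢ = 0`, `qᵢ = −σᵢ`, `rᵢ = υᵢ` (then `pᵢ − qᵢ = σᵢ`, `qᵢ − rᵢ = τᵢ` by `σᵢ + τᵢ + υᵢ = 0`, `rᵢ − pᵢ = υᵢ`).
[cite: BlasiakChurchCohnGrochowNaslundSawinUmans2017, Def. 3.1] -/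
theorem exists_isSTPP_singleton_of_isTricoloredSumFree {σ τ υ : Fin k → H} (hT : IsTricoloredSumFree σ τ υ) :
    ∃ A B C : Fin k → Finset H, IsSTPP A B C ∧ ∀ i, (A i).card = 1 ∧ (B i).card = 1 ∧ (C i).card = 1 := by
  refine ⟨fun _ => {0}, fun i => {-σ i}, fun i => {υ i}, ?_, fun i => ⟨card_singleton _, card_singleton _, card_singleton _⟩⟩
  have key : IsTricoloredSumFree (fun i => (0 : H) - -σ i) (fun i => -σ i - υ i) (fun i => υ i - 0) := by
    intro i j l
    have hτ : ∀ x, -σ x - υ x = τ x := fun x => by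
      have := hT.sum_eq_zero x
      rw [sub_eq_iff_eq_add, neg_eq_iff_add_eq_zero, ← this]; abel
    simp only [zero_sub, neg_neg, sub_zero, hτ]
    exact hT i j l
  exact (isSTPP_singleton_iff_isTricoloredSumFree _ _ _).2 key

end Singletons

end Summit.MatrixMultiplication.OmegaCensus
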